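import Mathlib
import HarnessLib
import Literature.MathematicalPhysics.QuantumLattice.GaugeGroupsProofs
import Summits.Ventures.LatticeQCDFlow.Exactness.SUNExpChart
import Summits.Ventures.LatticeQCDFlow.Exactness.LocalBallComparison
import Summits.Ventures.LatticeQCDFlow.Exactness.GroupMetropolisLinkErgodic
import Summits.Ventures.LatticeQCDFlow.Exactness.CabibboMarinariKernel

/-!
# The exponential chart of `SU(N)` dominates a multiple of Haar measure near the identity: kicks with a Lebesgue-minorised algebra element cover, and the N-hit link Metropolis on `SU(N)` is uniformly ergodic

HONEST FRAMING: exact (Metropolis-corrected) sampling algorithms for lattice gauge theory;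
figures of merit are autocorrelation/cost numbers at stated couplings and volumes; no
continuum-physics claim.

Venture `LatticeQCDFlow` (cell pub-lqcd), topic `Exactness`, FANOUT row 9 (eng-latcore, the
engine `latflow.core`: the `SU(N)` N-hit link Metropolis `U ← exp(X) U` of
`updates.sweep_metropolis` / `sun_2d.sweep_metropolis`, `N ≥ 3` — the row the exactness table
listed as NOT CLAIMED for want of an exponential-chart Haar density on `SU(N)`).  NEW WORK of the
cell over Mathlib and the tree (`SUNExpChart.lean`: the chart maps and the two containments;
`LocalBallComparison.lean`: ball comparison ⇒ domination by Lebesgue; `ConnectedGroupKickCovering.lean`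
/ `GroupMetropolisLinkErgodic.lean`: a step law dominating Haar near `1` on a connected compact
group covers, and the N-hit link Metropolis is then uniformly ergodic; Literature
`GaugeGroupsProofs`: `SU(N)` is connected — imported by name).  Nothing here is cited as a fact.
Printed counterparts, NAMED ONLY: the smoothness of Haar measure on a Lie group (e.g. Knapp,
*Lie Groups Beyond an Introduction*, VIII §2) — here replaced by a QUALITATIVE statement proved from
the inverse function theorem, left invariance and Besicovitch–Vitali, with no differential geometry:

* §1 `logLaw` — Haar of `SU(N)` restricted to the chart neighbourhood and read through the
  logarithm, a finite measure on the coordinate space `E`; `logLaw_apply` (`= Haar (logBall B)`);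
  `haar_image_mul` (left invariance on images); **`logLaw_ball_comparison`** — the two ball
  inequalities `λ(B̄(0,ρ)) ≤ λ(B̄(x,Lρ))`, `λ(B̄(x,ρ)) ≤ λ(B̄(0,Lρ))` from the containments.
* §2 **`exists_smul_haar_restrict_le_map_suExp`** — THE CHART MINORISATION: for every additive Haar
  measure `μ` on `E` and every neighbourhood `W` of `0` there are a neighbourhood `V` of `1` in
  `SU(N)` and `c ≠ 0` with `c • Haar|_V ≤ (μ|_W) ∘ suExp⁻¹` — Lebesgue measure on any small set of
  the Lie algebra, pushed through `exp`, dominates a multiple of Haar measure near the identity.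
* §3 **`sunKick_nHit_minorised`** — consequently ANY step law on `SU(N)` dominating
  `c • (μ|_W) ∘ suExp⁻¹` has some number of kicks dominating `δ ·` Haar from EVERY start;
  **`sunLinkMetropolis_uniformlyErgodic`** — and for such an inversion-invariant probability step law
  and a measurable weight pinched `0 < m ≤ p ≤ M`, the `k`-hit link Metropolis `symMH (mulWalk ν) p`
  converges to `Z⁻¹ p · Haar` geometrically in total variation from every initial law, `Z⁻¹ p · Haar`
  being the only probability law invariant under one hit (`N ≥ 1`; the engine's kick law is the
  instance of `SUNMetropolisKickLaw.lean`).

NOT CLAIMED: any value of `c`, of the neighbourhoods, of the number of kicks or of the rate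
(inverse function theorem + compactness); a density formula; `U(N)`.
-/

noncomputable section

namespace Summit.Ventures.LatticeQCDFlow.Exactness

open MeasureTheory Measure ProbabilityTheory Set Filter Topology Metric Function NormedSpace
open Literature.MathematicalPhysics.QuantumFieldTheory (haarProbability)
open Literature.MathematicalPhysics.QuantumLattice (connectedSpace_specialUnitaryGroup)
open scoped Matrix Matrix.Norms.Operator NNReal ENNReal

set_option backward.isDefEq.respectTransparency false

variable {n : Type*} [Fintype n] [DecidableEq n]
variable {E : Type*} [NormedAddCommGroup E] [NormedSpace ℝ E] [FiniteDimensional ℝ E] [MeasurableSpace E] [BorelSpace E]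
variable (ι : E →ₗ[ℝ] Matrix n n ℂ) (hι : ∀ a, (ι a)ᴴ = -ι a ∧ (ι a).trace = 0)

/-! ## §1 Haar measure read through the logarithm -/

/-- **`logLaw`**: the Haar probability of `SU(N)` restricted to the chart neighbourhood, pushed to the
coordinate space by the logarithm. -/
def logLaw (hinj : Injective ι) : Measure E :=
  ((haarProbability (Matrix.specialUnitaryGroup n ℂ)).restrict (suChartSet (n := n))).map (suLog ι hinj)

/-- `logLaw` is a finite measure. -/
instance isFiniteMeasure_logLaw (hinj : Injective ι) : IsFiniteMeasure (logLaw (n := n) ι hinj) := by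
  unfold logLaw; infer_instance

omit [FiniteDimensional ℝ E] in
/-- `suLog` is a.e.-measurable for Haar restricted to the chart neighbourhood. -/
theorem aemeasurable_suLog (hinj : Injective ι) :
    AEMeasurable (suLog ι hinj) ((haarProbability (Matrix.specialUnitaryGroup n ℂ)).restrict (suChartSet (n := n))) :=
  (continuousOn_suLog ι hinj).aemeasurable isOpen_suChartSet.measurableSet

omit [FiniteDimensional ℝ E] in
/-- **`logLaw B = Haar (logBall B)`** for measurable `B`. -/
theorem logLaw_apply (hinj : Injective ι) {B : Set E} (hB : MeasurableSet B) :
    logLaw ι hinj B = haarProbability (Matrix.specialUnitaryGroup n ℂ) (logBall (n := n) ι hinj B) := by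
  rw [logLaw, Measure.map_apply_of_aemeasurable (aemeasurable_suLog ι hinj) hB,
    Measure.restrict_apply' isOpen_suChartSet.measurableSet, logBall, inter_comm]

/-- Left invariance of Haar measure on images: `Haar (g · A) = Haar A`. -/
theorem haar_image_mul (g : Matrix.specialUnitaryGroup n ℂ) (A : Set (Matrix.specialUnitaryGroup n ℂ)) :
    haarProbability (Matrix.specialUnitaryGroup n ℂ) ((fun U => g * U) '' A) =
      haarProbability (Matrix.specialUnitaryGroup n ℂ) A := by
  rw [image_mul_left, measure_preimage_mul]

omit [FiniteDimensional ℝ E] in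
/-- **THE TWO BALL INEQUALITIES** for `logLaw`, from the containments of `SUNExpChart.lean` and left
invariance: with `L = max K 1`, for `x ∈ B(0,R/2)` and `0 < ρ ≤ R/2`,
`λ(B̄(0,ρ)) ≤ λ(B̄(x,Lρ))` and `λ(B̄(x,ρ)) ≤ λ(B̄(0,Lρ))`. -/
theorem logLaw_ball_comparison (hinj : Injective ι) (hsurj : ∀ X : Matrix n n ℂ, Xᴴ = -X → X.trace = 0 → X ∈ LinearMap.range ι)
    {K : ℝ≥0} {R : ℝ} (hK : LipschitzOnWith K (mulLog ι hι hinj) (closedBall (0 : E × E) R))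
    (hprod : ∀ x ∈ closedBall (0 : E) R, ∀ a ∈ closedBall (0 : E) R, suExp ι hι x * suExp ι hι a ∈ suChartSet (n := n))
    (hsrc : ∀ x ∈ closedBall (0 : E) R, ι x ∈ (matrixExpChart (n := n)).source)
    {x : E} (hx : x ∈ ball (0 : E) (R / 2)) {ρ : ℝ} (hρ : 0 < ρ) (hρR : ρ ≤ R / 2) :
    logLaw ι hinj (closedBall 0 ρ) ≤ logLaw ι hinj (closedBall x (max (K : ℝ) 1 * ρ)) ∧
      logLaw ι hinj (closedBall x ρ) ≤ logLaw ι hinj (closedBall 0 (max (K : ℝ) 1 * ρ)) := by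
  have hx' : x ∈ closedBall (0 : E) (R / 2) := ball_subset_closedBall hx
  have hKL : (K : ℝ) * ρ ≤ max (K : ℝ) 1 * ρ := mul_le_mul_of_nonneg_right (le_max_left _ _) hρ.le
  rw [logLaw_apply ι hinj measurableSet_closedBall, logLaw_apply ι hinj measurableSet_closedBall,
    logLaw_apply ι hinj measurableSet_closedBall, logLaw_apply ι hinj measurableSet_closedBall]
  constructor
  · rw [← haar_image_mul (suExp ι hι x)]
    refine measure_mono ((image_mul_logBall_subset ι hι hinj hsurj hK hprod hsrc hx' hρR).trans ?_)
    exact inter_subset_inter_right _ (preimage_mono (closedBall_subset_closedBall hKL))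
  · rw [← haar_image_mul (suExp ι hι x) (logBall ι hinj (closedBall 0 (max (K : ℝ) 1 * ρ)))]
    refine measure_mono ((logBall_subset_image_mul ι hι hinj hsurj hK hprod hx' hρR).trans ?_)
    exact image_mono (inter_subset_inter_right _ (preimage_mono (closedBall_subset_closedBall hKL)))

/-! ## §2 The chart minorisation -/

/-- **THE EXPONENTIAL CHART OF `SU(N)` DOMINATES A MULTIPLE OF HAAR MEASURE NEAR THE IDENTITY.**
For coordinates `ι : E → 𝔰𝔲(N)` (injective, onto the skew-Hermitian traceless matrices), every
additive Haar measure `μ` on `E` and every neighbourhood `W` of `0`: there are a neighbourhood `V`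
of `1` in `SU(N)` and `c ≠ 0` with `c • Haar|_V ≤ (μ|_W) ∘ suExp⁻¹`. -/
theorem exists_smul_haar_restrict_le_map_suExp (hinj : Injective ι)
    (hsurj : ∀ X : Matrix n n ℂ, Xᴴ = -X → X.trace = 0 → X ∈ LinearMap.range ι)
    (μ : Measure E) [IsAddHaarMeasure μ] {W : Set E} (hW : W ∈ 𝓝 (0 : E)) :
    ∃ V ∈ 𝓝 (1 : Matrix.specialUnitaryGroup n ℂ), ∃ c : ℝ≥0∞, c ≠ 0 ∧
      c • (haarProbability (Matrix.specialUnitaryGroup n ℂ)).restrict V ≤ (μ.restrict W).map (suExp ι hι) := by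
  obtain ⟨K, R₀, hR₀, hgood⟩ := exists_goodRadius ι hι hinj
  obtain ⟨ε, hε, hεW⟩ := Metric.mem_nhds_iff.1 hW
  set R : ℝ := min R₀ ε with hRdef
  have hRpos : 0 < R := lt_min hR₀ hε
  obtain ⟨hK, hprod, hsrc⟩ := hgood R (min_le_left _ _)
  set L : ℝ := max (K : ℝ) 1 with hL
  -- the two ball inequalities on the core ball `B(0, R/2)` for radii `≤ R/2`
  have h₁ : ∀ x ∈ ball (0 : E) (R / 2), ∀ ρ : ℝ, 0 < ρ → ρ ≤ R / 2 →
      logLaw ι hinj (closedBall 0 ρ) ≤ logLaw ι hinj (closedBall x (L * ρ)) :=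
    fun x hx ρ hρ hρR => (logLaw_ball_comparison ι hι hinj hsurj hK hprod hsrc hx hρ hρR).1
  have h₂ : ∀ x ∈ ball (0 : E) (R / 2), ∀ ρ : ℝ, 0 < ρ → ρ ≤ R / 2 →
      logLaw ι hinj (closedBall x ρ) ≤ logLaw ι hinj (closedBall 0 (L * ρ)) :=
    fun x hx ρ hρ hρR => (logLaw_ball_comparison ι hι hinj hsurj hK hprod hsrc hx hρ hρR).2
  obtain ⟨C, hC0, hle⟩ := restrict_le_smul_of_closedBall_comparison (μ := μ) (lam := logLaw ι hinj)
    (half_pos hRpos) (half_pos hRpos) (le_max_right _ _) h₁ h₂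
  -- the neighbourhood `V` of `1`
  set V : Set (Matrix.specialUnitaryGroup n ℂ) := logBall ι hinj (ball (0 : E) (R / 2)) with hV
  have hVopen : IsOpen V := (continuousOn_suLog ι hinj).isOpen_inter_preimage isOpen_suChartSet isOpen_ball
  have h1V : (1 : Matrix.specialUnitaryGroup n ℂ) ∈ V := by
    refine ⟨one_mem_suChartSet, ?_⟩
    rw [mem_preimage, suLog_one]; exact mem_ball_self (half_pos hRpos)
  have hmeas : Measurable (suExp ι hι) := (continuous_suExp ι hι).measurable
  have hballW : ball (0 : E) (R / 2) ⊆ W :=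
    (ball_subset_ball (by linarith [min_le_right R₀ ε])).trans hεW
  -- `Haar|_V ≤ C • (μ|_W) ∘ suExp⁻¹`
  have hmain : (haarProbability (Matrix.specialUnitaryGroup n ℂ)).restrict V ≤
      (C : ℝ≥0∞) • (μ.restrict W).map (suExp ι hι) := by
    refine Measure.le_iff.2 fun A hA => ?_
    have hAm : MeasurableSet (suExp ι hι ⁻¹' A) := hA.preimage hmeas
    rw [Measure.restrict_apply hA, Measure.smul_apply, smul_eq_mul, Measure.map_apply hmeas hA,
      Measure.restrict_apply hAm]
    have hsub : A ∩ V ⊆ logBall ι hinj (suExp ι hι ⁻¹' A ∩ ball (0 : E) (R / 2)) := by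
      rintro U ⟨hUA, hUS, hUlog⟩
      refine ⟨hUS, ?_, hUlog⟩
      change suExp ι hι (suLog ι hinj U) ∈ A
      rw [suExp_suLog ι hι hinj hsurj hUS]; exact hUA
    calc haarProbability (Matrix.specialUnitaryGroup n ℂ) (A ∩ V)
        ≤ haarProbability (Matrix.specialUnitaryGroup n ℂ) (logBall ι hinj (suExp ι hι ⁻¹' A ∩ ball (0 : E) (R / 2))) :=
          measure_mono hsub
      _ = (logLaw ι hinj).restrict (ball 0 (R / 2)) (suExp ι hι ⁻¹' A) := by
          rw [Measure.restrict_apply hAm, logLaw_apply ι hinj (hAm.inter measurableSet_ball)]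
      _ ≤ ((C : ℝ≥0∞) • μ.restrict (ball 0 (R / 2))) (suExp ι hι ⁻¹' A) := Measure.le_iff'.1 hle _
      _ = (C : ℝ≥0∞) * μ (suExp ι hι ⁻¹' A ∩ ball 0 (R / 2)) := by
          rw [Measure.smul_apply, smul_eq_mul, Measure.restrict_apply hAm]
      _ ≤ (C : ℝ≥0∞) * μ (suExp ι hι ⁻¹' A ∩ W) := by
          gcongr
  refine ⟨V, hVopen.mem_nhds h1V, (C : ℝ≥0∞)⁻¹, ENNReal.inv_ne_zero.2 ENNReal.coe_ne_top, ?_⟩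
  calc (C : ℝ≥0∞)⁻¹ • (haarProbability (Matrix.specialUnitaryGroup n ℂ)).restrict V
      ≤ (C : ℝ≥0∞)⁻¹ • ((C : ℝ≥0∞) • (μ.restrict W).map (suExp ι hι)) := by
        refine Measure.le_iff'.2 fun A => ?_
        simp only [Measure.smul_apply, smul_eq_mul]
        exact mul_le_mul' le_rfl (Measure.le_iff'.1 hmain A)
    _ = (μ.restrict W).map (suExp ι hι) := by
        rw [smul_smul, ENNReal.inv_mul_cancel (ENNReal.coe_ne_zero.2 hC0.ne') ENNReal.coe_ne_top, one_smul]

/-! ## §3 Covering and the N-hit link Metropolis on `SU(N)` -/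

/-- **ON `SU(N)`, A STEP LAW DOMINATING LEBESGUE-THROUGH-THE-CHART NEAR `1` COVERS**: if
`ν ≥ c • (μ|_W) ∘ suExp⁻¹` for an additive Haar measure `μ` on the coordinate space, a neighbourhood
`W` of `0` and `c ≠ 0`, then some number `k` of `ν`-kicks dominates `δ ·` Haar from EVERY start. -/
theorem sunKick_nHit_minorised [Nonempty n] (hinj : Injective ι)
    (hsurj : ∀ X : Matrix n n ℂ, Xᴴ = -X → X.trace = 0 → X ∈ LinearMap.range ι)
    (μ : Measure E) [IsAddHaarMeasure μ] {W : Set E} (hW : W ∈ 𝓝 (0 : E))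
    {ν : Measure (Matrix.specialUnitaryGroup n ℂ)} [SFinite ν] {c : ℝ≥0∞} (hc : c ≠ 0)
    (hν : c • (μ.restrict W).map (suExp ι hι) ≤ ν) :
    ∃ k : ℕ, ∃ δ : ℝ≥0∞, 0 < δ ∧ ∀ u : Matrix.specialUnitaryGroup n ℂ,
      δ • haarProbability (Matrix.specialUnitaryGroup n ℂ) ≤ nHit (mulWalk ν) k u := by
  haveI : ConnectedSpace (Matrix.specialUnitaryGroup n ℂ) := connectedSpace_specialUnitaryGroup
  obtain ⟨V, hV, c', hc', hle⟩ := exists_smul_haar_restrict_le_map_suExp ι hι hinj hsurj μ hW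
  refine exists_nHit_mulWalk_minorised hV (mul_ne_zero hc hc') ?_
  calc (c * c') • (haarProbability (Matrix.specialUnitaryGroup n ℂ)).restrict V
      = c • (c' • (haarProbability (Matrix.specialUnitaryGroup n ℂ)).restrict V) := by rw [mul_smul]
    _ ≤ c • (μ.restrict W).map (suExp ι hι) := by
        refine Measure.le_iff'.2 fun A => ?_
        simp only [Measure.smul_apply, smul_eq_mul]
        exact mul_le_mul' le_rfl (Measure.le_iff'.1 hle A)
    _ ≤ ν := hν

/-- **THE N-HIT `SU(N)` LINK METROPOLIS IS UNIFORMLY ERGODIC** for every inversion-invariant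
probability step law dominating Lebesgue-through-the-chart near `1` and every measurable weight
pinched `0 < m ≤ p ≤ M`: there are `k` and `ε ∈ (0, 1]` with
`|μ₀(K^k)ᵗ(A) − (Z⁻¹p·Haar)(A)| ≤ (1 − ε)ᵗ` for every initial law, `K = symMH (mulWalk ν) p`, and
`Z⁻¹ p · Haar` is the only probability law invariant under one hit. -/
theorem sunLinkMetropolis_uniformlyErgodic [Nonempty n] (hinj : Injective ι)
    (hsurj : ∀ X : Matrix n n ℂ, Xᴴ = -X → X.trace = 0 → X ∈ LinearMap.range ι)
    (μ : Measure E) [IsAddHaarMeasure μ] {W : Set E} (hW : W ∈ 𝓝 (0 : E))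
    {ν : Measure (Matrix.specialUnitaryGroup n ℂ)} [IsProbabilityMeasure ν] [ν.IsInvInvariant]
    {c : ℝ≥0∞} (hc : c ≠ 0) (hν : c • (μ.restrict W).map (suExp ι hι) ≤ ν)
    {p : Matrix.specialUnitaryGroup n ℂ → ℝ} {m M : ℝ} (hp : Measurable p) (hm : 0 < m)
    (hpm : ∀ x, m ≤ p x) (hpM : ∀ x, p x ≤ M) :
    ∃ k : ℕ, ∃ ε : ℝ, 0 < ε ∧ ε ≤ 1 ∧
      (∀ (μ₀ : Measure (Matrix.specialUnitaryGroup n ℂ)) [IsProbabilityMeasure μ₀] (t : ℕ)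
          (A : Set (Matrix.specialUnitaryGroup n ℂ)),
        |((fun m' : Measure (Matrix.specialUnitaryGroup n ℂ) => m'.bind (nHit (symMH (mulWalk ν) p) k))^[t] μ₀).real A
            - (gibbsProbability (haarProbability (Matrix.specialUnitaryGroup n ℂ)) p).real A| ≤ (1 - ε) ^ t) ∧
      ∀ (π' : Measure (Matrix.specialUnitaryGroup n ℂ)) [IsProbabilityMeasure π'],
        Kernel.Invariant (symMH (mulWalk ν) p) π' →
          π' = gibbsProbability (haarProbability (Matrix.specialUnitaryGroup n ℂ)) p := by
  haveI : ConnectedSpace (Matrix.specialUnitaryGroup n ℂ) := connectedSpace_specialUnitaryGroup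
  obtain ⟨V, hV, c', hc', hle⟩ := exists_smul_haar_restrict_le_map_suExp ι hι hinj hsurj μ hW
  refine groupLinkMetropolis_uniformlyErgodic_of_nhds hV (mul_ne_zero hc hc') ?_ hp hm hpm hpM
  calc (c * c') • (haarProbability (Matrix.specialUnitaryGroup n ℂ)).restrict V
      = c • (c' • (haarProbability (Matrix.specialUnitaryGroup n ℂ)).restrict V) := by rw [mul_smul]
    _ ≤ c • (μ.restrict W).map (suExp ι hι) := by
        refine Measure.le_iff'.2 fun A => ?_
        simp only [Measure.smul_apply, smul_eq_mul]
        exact mul_le_mul' le_rfl (Measure.le_iff'.1 hle A)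
    _ ≤ ν := hν

end Summit.Ventures.LatticeQCDFlow.Exactness
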